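import Summits.ValiantsHypothesis.ValiantsHypothesis.Theorems.NNDivisionHard.Negative.PermBlind

/-!
# PermBlind, part 2 (§3 the identity, §4 the packaged factorization `permPassenger_cliqueBlind`) — Negative-lane port of val-idea-41 g3's `PermBlind41.lean`, part 2/2

PORT NOTE (val-port-3 g3; desk val-lit RULINGS #365 (B) / #366 (C)(iii); author val-idea-41 g3, ALL CREDIT): Negative-lane port of the crux workfile
`Cruxes/NNDivisionHard/PermBlind41.lean` @a440a32060f5 (tree sha16 62fe778729d1fda9, 536 l.; `import Mathlib` only; 0 `sorry`; critic of record val-idea-crit-9 g2 VERDICT (rows 69–73 block, 2026-08-28T23:34:49Z): «★★ KEEP (R1 instrument, VERIFIED) — `permPassenger_cliqueBlind` axioms std»), texts VERBATIM BY NAME under the Negative-lane namespace `…Theorems.NNDivisionHardNegative.PermBlind`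
(the workfile's `…Cruxes.NNDivisionHard.PermBlind41` is not importable from `Theorems/`); the ONLY other changes are 36 one-line docstrings on helper
lemmas/defs (gate lint), the scratch's `set_option linter.unusedVariables false` DROPPED and the five unused binders of `col0`–`col3`/`col5`–`col7` `_`-prefixed instead (0 warnings), and the 400-line-cap SPLIT: part 1 `…/Negative/PermBlind.lean` = §0–§2 (indicators, double sums, atom families); part 2 (this file) = §3 `slack_identity`, §4 `factorization` / ★ `permPassenger_cliqueBlind` ((n+1)(8n²+1) slots, λ = 4n+2).
21181 OPEN; C⁺_entry DEAD in kernel (✓ p679540) independently of this file; VP ≠ VNP is NOT proved.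
-/

-- the mandated summit-side namespace repeats a component by design (single-problem summit)
set_option linter.dupNamespace false

namespace Summit.ValiantsHypothesis.Theorems.NNDivisionHardNegative.PermBlind

open Finset BigOperators

noncomputable section

variable {n : ℕ}

/-! ## §3 The identity -/

/-- scalar statistics of a row `a` against the located set `I^π_k` and the column set `b`. -/
def tQ (a b : Finset (Fin n)) (π : Equiv.Perm (Fin n)) (k : ℕ) : ℝ :=
  ∑ l, xa a l * (1 - io π k l) * xa b l
/-- `m = |(I ∖ a) ∩ b|`. (docstring added in the port) -/
def mQ (a b : Finset (Fin n)) (π : Equiv.Perm (Fin n)) (k : ℕ) : ℝ :=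
  ∑ l, (1 - xa a l) * io π k l * xa b l
/-- `d = |a ∖ I|`. (docstring added in the port) -/
def dQ (a : Finset (Fin n)) (π : Equiv.Perm (Fin n)) (k : ℕ) : ℝ := ∑ l, xa a l * (1 - io π k l)
/-- `d' = |I ∖ a|`. (docstring added in the port) -/
def dQ' (a : Finset (Fin n)) (π : Equiv.Perm (Fin n)) (k : ℕ) : ℝ := ∑ l, (1 - xa a l) * io π k l
/-- `e = |a ∩ I|`. (docstring added in the port) -/
def eQ (a : Finset (Fin n)) (π : Equiv.Perm (Fin n)) (k : ℕ) : ℝ := ∑ l, xa a l * io π k l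
/-- the leading budget `Σ_{l ∈ a∖I} (π l + 1 − k)`. -/
def A6K (a : Finset (Fin n)) (π : Equiv.Perm (Fin n)) (k : ℕ) : ℝ :=
  ∑ l, xa a l * (1 - io π k l) * (((π l : ℕ) : ℝ) + 1 - k)
/-- the inversion family A7: `Σ xa·xa·(1 − io)·K`. (docstring added in the port) -/
def F7 (a : Finset (Fin n)) (π : Equiv.Perm (Fin n)) (k : ℕ) : ℝ :=
  ∑ l, ∑ l', xa a l * xa a l' * ((1 - io π k l) * K π l' l)
/-- the inversion family A8: `Σ xa·(1 − xa)·io·io·K`. (docstring added in the port) -/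
def F8 (a : Finset (Fin n)) (π : Equiv.Perm (Fin n)) (k : ℕ) : ℝ :=
  ∑ l, ∑ l', xa a l * (1 - xa a l') * (io π k l * io π k l' * K π l l')

/-- The inversion count splits along the located set:
`inv = Σ_{l∈a∖I}(π l + 1 − k) + F7 + F8` (for `|a| = k`). -/
lemma invR_split (a : Finset (Fin n)) (π : Equiv.Perm (Fin n)) (k : ℕ) (hak : a.card = k) :
    invR a π = A6K a π k + F7 a π k + F8 a π k := by
  have hk : k ≤ n := by
    rw [← hak]; exact le_trans (Finset.card_le_univ a) (by simp)
  unfold invR A6K F7 F8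
  rw [← Finset.sum_add_distrib, ← Finset.sum_add_distrib]
  refine Finset.sum_congr rfl (fun l _ => ?_)
  by_cases hl : l ∈ a
  · have hxl : xa a l = 1 := by simp [xa, hl]
    by_cases hι : (π l : ℕ) < k
    · have hιl : io π k l = 1 := by simp [io, hι]
      simp only [hxl, hιl, sub_self, mul_zero, zero_mul, zero_add, one_mul, Finset.sum_const_zero]
      -- goal: Σ (1 - x') K = Σ (1 - x') (ι' K)
      refine Finset.sum_congr rfl (fun l' _ => ?_)
      have h := io_K_io π k l l'
      rw [hιl] at h
      -- K * (1 - ι') = 0  ⇒  (1 - x') K = (1 - x') ι' K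
      linear_combination (1 - xa a l') * h
    · have hιl : io π k l = 0 := by simp [io, hι]
      simp only [hxl, hιl, sub_zero, mul_one, one_mul, zero_mul, mul_zero, Finset.sum_const_zero,
        add_zero]
      -- goal: Σ (1 - x') K_{ll'} = (π l + 1 - k) + Σ x' K_{l'l}
      have hKK : ∑ l', xa a l' * (K π l l' + K π l' l) = (k : ℝ) - 1 := by
        have h1 : ∀ l', xa a l' * (K π l l' + K π l' l) =
            xa a l' - (if l' = l then xa a l' else 0) := by
          intro l'
          rw [K_add_K π l l']
          by_cases h : l = l'
          · subst h; simp
          · have h' : ¬ l' = l := fun e => h e.symm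
            simp [h, h']
        simp_rw [h1]
        rw [Finset.sum_sub_distrib, sum_xa a, hak]
        simp [hxl]
      have hsK := sum_K π l
      have e1 : ∑ l', (1 - xa a l') * K π l l' = ∑ l', K π l l' - ∑ l', xa a l' * K π l l' := by
        rw [← Finset.sum_sub_distrib]
        refine Finset.sum_congr rfl (fun l' _ => by ring)
      have e2 : ∑ l', xa a l' * (K π l l' + K π l' l) =
          ∑ l', xa a l' * K π l l' + ∑ l', xa a l' * K π l' l := by
        rw [← Finset.sum_add_distrib]
        refine Finset.sum_congr rfl (fun l' _ => by ring)
      rw [e1, hsK]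
      rw [e2] at hKK
      linarith
  · have hxl : xa a l = 0 := by simp [xa, hl]
    simp [hxl]

/-- **The explicit factorization identity** (per size class `k = |a|`):
`UDISJ + λ·inv = (1 − s')² + Σ_{i<8} Σ_{l,l'} rowᵢ · colᵢ`. -/
theorem slack_identity (lam : ℝ) (a b : Finset (Fin n)) (π : Equiv.Perm (Fin n)) (k : ℕ)
    (hak : a.card = k) :
    M lam a b π = (1 - sI π k b) ^ 2 +
      ∑ i : Fin 8, ∑ l, ∑ l', rowv i a l l' * colv i lam b π k l l' := by
  have hk : k ≤ n := by
    rw [← hak]; exact le_trans (Finset.card_le_univ a) (by simp)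
  -- name the scalar statistics
  set s := ∑ l, xa a l * xa b l with hs_def
  set s' := sI π k b with hs'_def
  set m := mQ a b π k with hm_def
  set t := tQ a b π k with ht_def
  set d := dQ a π k with hd_def
  set d' := dQ' a π k with hd'_def
  set e := eQ a π k with he_def
  -- relations among them
  have hxe : e = (k : ℝ) - d := by
    have : e + d = ∑ l, xa a l := by
      rw [he_def, hd_def, eQ, dQ, ← Finset.sum_add_distrib]
      refine Finset.sum_congr rfl (fun l _ => by ring)
    rw [sum_xa a, hak] at this; linarith
  have hdd : d' = d := by
    have h1 : d' + e = ∑ l, io π k l := by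
      rw [hd'_def, he_def, dQ', eQ, ← Finset.sum_add_distrib]
      refine Finset.sum_congr rfl (fun l _ => by ring)
    rw [sum_io π k hk] at h1
    linarith
  have hss : s = s' - m + t := by
    rw [hs_def, hs'_def, hm_def, ht_def, sI, mQ, tQ, ← Finset.sum_sub_distrib,
      ← Finset.sum_add_distrib]
    refine Finset.sum_congr rfl (fun l _ => by ring)
  -- the eight families evaluated
  have hF0 : ∑ l, ∑ l', rowv 0 a l l' * colv 0 lam b π k l l' = m * m := by
    rw [hm_def, mQ, ← dsum_prod]
    exact dsum_congr (fun l l' => by simp [rowv, colv, row0, col0]; try ring)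
  have hF1 : ∑ l, ∑ l', rowv 1 a l l' * colv 1 lam b π k l l' = t * t := by
    rw [ht_def, tQ, ← dsum_prod]
    exact dsum_congr (fun l l' => by simp [rowv, colv, row1, col1]; try ring)
  have hF2 : ∑ l, ∑ l', rowv 2 a l l' * colv 2 lam b π k l l' = 2 * (d * d') - 2 * (t * m) := by
    rw [hd_def, hd'_def, ht_def, hm_def, dQ, dQ', tQ, mQ, ← dsum_prod, ← dsum_prod,
      ← dsum_const_mul, ← dsum_const_mul, ← dsum_sub]
    exact dsum_congr (fun l l' => by simp [rowv, colv, row2, col2]; try ring)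
  have hF3 : ∑ l, ∑ l', rowv 3 a l l' * colv 3 lam b π k l l' = 2 * (d * e) := by
    rw [hd_def, he_def, dQ, eQ, ← dsum_prod, ← dsum_const_mul]
    exact dsum_congr (fun l l' => by simp [rowv, colv, row1, col3]; try ring)
  have hF4 : ∑ l, ∑ l', rowv 4 a l l' * colv 4 lam b π k l l' =
      (2 * d - 2 * t + 2 * s' * t) + (lam * A6K a π k - (4 * k + 2) * d) := by
    have e1 : ∑ l, ∑ l', rowv 4 a l l' * colv 4 lam b π k l l' =
        ∑ l, ∑ l', (if l' = l then (1 : ℝ) else 0) * (xa a l * xa a l' * ((1 - io π k l) *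
          (2 - 2 * xa b l + 2 * sI π k b * xa b l +
            (lam * (((π l : ℕ) : ℝ) + 1 - k) - 4 * k - 2)))) :=
      dsum_congr (fun l l' => by simp [rowv, colv, row1, col4]; try ring)
    rw [e1, dsum_delta]
    rw [hd_def, ht_def, hs'_def, dQ, tQ, A6K]
    simp only [Finset.mul_sum, ← Finset.sum_sub_distrib, ← Finset.sum_add_distrib]
    refine Finset.sum_congr rfl (fun l _ => ?_)
    have := xa_mul_self a l
    linear_combination ((1 - io π k l) * (2 - 2 * xa b l + 2 * sI π k b * xa b l +
      (lam * (((π l : ℕ) : ℝ) + 1 - k) - 4 * k - 2))) * this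
  have hF5 : ∑ l, ∑ l', rowv 5 a l l' * colv 5 lam b π k l l' =
      2 * k * d' + 2 * (1 - s') * m := by
    have e1 : ∑ l, ∑ l', rowv 5 a l l' * colv 5 lam b π k l l' =
        ∑ l, ∑ l', (if l' = l then (1 : ℝ) else 0) * ((1 - xa a l) * (1 - xa a l') *
          (io π k l * (2 * k + 2 * (1 - sI π k b) * xa b l))) :=
      dsum_congr (fun l l' => by simp [rowv, colv, row0, col5]; try ring)
    rw [e1, dsum_delta]
    rw [hd'_def, hm_def, hs'_def, dQ', mQ]
    simp only [Finset.mul_sum, ← Finset.sum_add_distrib]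
    refine Finset.sum_congr rfl (fun l _ => ?_)
    have := xa_mul_self a l
    linear_combination (io π k l * (2 * (k : ℝ) + 2 * (1 - sI π k b) * xa b l)) * this
  have hF6 : ∑ l, ∑ l', rowv 6 a l l' * colv 6 lam b π k l l' = lam * F7 a π k := by
    rw [F7, ← dsum_const_mul]
    exact dsum_congr (fun l l' => by simp [rowv, colv, row1, col6]; try ring)
  have hF7 : ∑ l, ∑ l', rowv 7 a l l' * colv 7 lam b π k l l' = lam * F8 a π k := by
    rw [F8, ← dsum_const_mul]
    exact dsum_congr (fun l l' => by simp [rowv, colv, row2, col7]; try ring)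
  -- assemble
  have hinv := invR_split a π k hak
  rw [Fin.sum_univ_eight, hF0, hF1, hF2, hF3, hF4, hF5, hF6, hF7]
  unfold M
  rw [← hs_def, hinv, hss, hdd, hxe]
  ring

/-! ## §4 Packaging: a nonnegative factorization with `(n+1)(8n²+1)` slots -/

/-- slot index: a size class `k` and either the constant atom or a family/pair atom. -/
abbrev Slot (n : ℕ) := Fin (n + 1) × Option (Fin 8 × Fin n × Fin n)

/-- `|Slot n| = (n+1)(8n²+1)`. (docstring added in the port) -/
lemma card_Slot (n : ℕ) : Fintype.card (Slot n) = (n + 1) * (8 * n ^ 2 + 1) := by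
  simp [Slot, Fintype.card_prod, Fintype.card_option, Fintype.card_fin]
  ring

/-- the row matrix `U`. -/
def U (a : Finset (Fin n)) : Slot n → ℝ
  | (k, none) => if a.card = (k : ℕ) then 1 else 0
  | (k, some (i, l, l')) => (if a.card = (k : ℕ) then 1 else 0) * rowv i a l l'

/-- the column matrix `V`. -/
def V (lam : ℝ) (c : Finset (Fin n) × Equiv.Perm (Fin n)) : Slot n → ℝ
  | (k, none) => (1 - sI c.2 k c.1) ^ 2
  | (k, some (i, l, l')) => colv i lam c.1 c.2 k l l'

/-- The packaged row factors are nonnegative. (docstring added in the port) -/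
lemma U_nonneg (a : Finset (Fin n)) (s : Slot n) : 0 ≤ U a s := by
  rcases s with ⟨k, _ | ⟨i, l, l'⟩⟩
  · simp only [U]; split_ifs <;> norm_num
  · simp only [U]
    exact mul_nonneg (by split_ifs <;> norm_num) (rowv_nonneg i a l l')

/-- The packaged column factors are nonnegative for `λ ≥ 4n + 2`. (docstring added in the port) -/
lemma V_nonneg (lam : ℝ) (hlam : 4 * (n : ℝ) + 2 ≤ lam) (c : Finset (Fin n) × Equiv.Perm (Fin n))
    (s : Slot n) : 0 ≤ V lam c s := by
  rcases s with ⟨k, _ | ⟨i, l, l'⟩⟩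
  · simp only [V]; positivity
  · simp only [V]
    exact colv_nonneg i lam c.1 c.2 k (Nat.lt_succ_iff.mp k.isLt) hlam l l'

/-- the factorization `M = U · Vᵀ`. -/
theorem factorization (lam : ℝ) (a b : Finset (Fin n)) (π : Equiv.Perm (Fin n)) :
    ∑ s : Slot n, U a s * V lam (b, π) s = M lam a b π := by
  have hcard : a.card < n + 1 :=
    Nat.lt_succ_of_le (le_trans (Finset.card_le_univ a) (by simp))
  set k₀ : Fin (n + 1) := ⟨a.card, hcard⟩ with hk₀
  rw [Fintype.sum_prod_type]
  rw [Finset.sum_eq_single k₀]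
  · -- the size class of `a`
    rw [Fintype.sum_option]
    have hU0 : U a (k₀, none) = 1 := by simp [U, hk₀]
    rw [hU0, one_mul]
    simp only [V]
    rw [slack_identity lam a b π (k₀ : ℕ) (by simp [hk₀])]
    congr 1
    rw [Fintype.sum_prod_type, Finset.sum_comm]
    rw [Finset.sum_comm]
    refine Finset.sum_congr rfl (fun i _ => ?_)
    rw [Fintype.sum_prod_type]
    refine Finset.sum_congr rfl (fun l _ => Finset.sum_congr rfl (fun l' _ => ?_))
    simp [U, hk₀]
  · intro k _ hk
    have hne : ¬ a.card = (k : ℕ) := by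
      intro h; apply hk; apply Fin.ext; simp [hk₀, h]
    apply Finset.sum_eq_zero
    intro o _
    rcases o with _ | ⟨i, l, l'⟩ <;> simp [U, hne]
  · intro h; exact absurd (Finset.mem_univ k₀) h

/-- **Main theorem.**  The permutahedral passenger `Q^Π_{4n+2}` is clique-row blind:
`(1 − |a∩b|)² + (4n+2)·inv(a;π)` has a nonnegative factorization with `(n+1)(8n²+1)` slots. -/
theorem permPassenger_cliqueBlind (n : ℕ) :
    ∃ (U : Finset (Fin n) → Slot n → ℝ) (V : Finset (Fin n) × Equiv.Perm (Fin n) → Slot n → ℝ),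
      Fintype.card (Slot n) = (n + 1) * (8 * n ^ 2 + 1) ∧
      (∀ a s, 0 ≤ U a s) ∧ (∀ c s, 0 ≤ V c s) ∧
      ∀ (a b : Finset (Fin n)) (π : Equiv.Perm (Fin n)),
        (1 - ((a ∩ b).card : ℝ)) ^ 2 + (4 * n + 2) * (inv a π : ℝ) = ∑ s, U a s * V (b, π) s := by
  refine ⟨U, V (4 * n + 2), card_Slot n, U_nonneg, V_nonneg _ le_rfl, ?_⟩
  intro a b π
  rw [factorization, M, sum_xa_mul_xa, inv_cast]

end

end Summit.ValiantsHypothesis.Theorems.NNDivisionHardNegative.PermBlind
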